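import Summits.Ventures.AbcSig.Sieve.Eisenstein
import Mathlib.NumberTheory.LegendreSymbol.Basic

/-!
# Venture AbcSig — kernel checker for EISENSTEIN CONGRUENCES WITH A QUADRATIC CHARACTER PAIR (cell module M6χ)

HONEST FRAMING. Certificate checker of a COMPUTATION cell (`pub-abcsig`). It proves NO Diophantine statement, makes no
claim on ABC or any summit, and does NOT verify the newform computation. It is the twin of `Sieve/Eisenstein.lean`
(module M6) for the character family of the cell's ruling R6 v2 = "module M6χ" (lead ruling 2026-08-22T20:15:48Z):
a residual exponent `n` of the trace sieve at an orbit `f` of level `N` is removed by a prime `𝔫 = (n, θ − r)` of the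
Hecke order and an Eisenstein series
`G_λ = Σ_t λ_t · E_χ(tz)`, `E_χ := ½ E₂^{χ,χ} = Σ_{m ≥ 1} σ₁^{χ,χ}(m) q^m`, `σ₁^{χ,χ}(m) = Σ_{d ∣ m} χ(m/d) χ(d) d`,
where `χ = (·/C)` is the Legendre symbol modulo an odd prime `C` with `C² ∣ N` and `t·C² ∣ N` (so that every
`E_χ(tz)` is a modular form of weight 2 on `Γ₀(N)` with TRIVIAL character `χ² = 1` and integer coefficients, constant
term `0` [DS05, Thm. 4.5.1, §4.6: `E₂^{ψ,φ} = δ(ψ)L(−1,φ) + 2Σ σ₁^{ψ,φ}(n)qⁿ ∈ M₂(N, ψφ)`, pinned AS PRINTED in the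
cell's `lit/M6CHI-PIN.md`]) with `a_m(f) ≡ a_m(G_λ) (mod 𝔫)` for all `m` up to the weight-2 Sturm bound. By
[Sturm 1987, Thm. 1] the congruence then holds for all `m`; since `a_1(f) = 1` this forces `a_1(G_λ) ≡ 1`, hence
`c_p(f) ≡ χ(p)(1 + p) (mod 𝔫)` for every prime `p ∤ N` [DS05, Prop. 5.2.3], so `ρ̄_{f,𝔫}^{ss} ≅ χ ⊕ χ·ω_n` is
reducible (Chebotarev + Brauer–Nesbitt; [DS05, Thm. 9.6.6] for the Eisenstein side) and cannot be the (absolutely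
irreducible, [BS04, Cor. 3.1]) mod-`n` representation of a Frey curve. THIS FILE checks the FINITE part in the kernel:

* `eulerChi C d` — the Legendre symbol `(d/C)` COMPUTED by Euler's criterion (`d^{(C−1)/2} mod C ∈ {0, 1, C−1}`);
  `eulerChi_eq_legendreSym` certifies that it IS Mathlib's `legendreSym C d` for an odd prime `C`.
* `sigmaChi C m = σ₁^{χ,χ}(m)` and `eisChiCoeff C λ m = a_m(G_λ) = Σ_t λ_t [t ∣ m] σ₁^{χ,χ}(m/t)` (`a_0 = 0`).
* `M.EisensteinChiCongruent f ψ C λ B` — the model-side statement: `C` is an odd prime with `C² ∣ N`, `λ` is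
  supported on `t ≥ 1` with `t·C² ∣ N`, and for every `1 ≤ m ≤ B`, `ψ(a_m(f)) = a_m(G_λ)` in `k`, where `a_m(f)` is
  `coeffOfFac N (c_·(f))` of a prime factorisation of `m` (the `m`-th Fourier coefficient in the intended model,
  [DS05, Prop. 5.8.5]) — exactly the shape of `M.EisensteinCongruent` with `eisCoeff` replaced by `eisChiCoeff`.
* `EisChiCert`, `EisChiCert.check c N X` (Boolean, `decide`) and `EisChiCert.check_sound`: a passing check gives
  `M.EisensteinChiCongruent f ψ c.C c.lam c.B ∧ SturmReaches N c.B` for every newform `f` carrying the extended data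
  `X` with generator `θ` and every ring homomorphism `ψ : Coeff f → k` to a field of characteristic `c.n` with
  `ψ(θ) = c.r`. The eigenvalue bookkeeping (`eigAt`, inverses of denominators, `coeffOfFac`, factorisations,
  `psiOfFac`, `SturmReaches`) is REUSED from `Sieve/Eisenstein.lean` via `EisChiCert.toEis`.

What is NOT here: the CITED step (Sturm ⇒ reducible ⇒ does not arise) and the composition with rows — see
`Recipes/EisChiPackage.lean` (named hypothesis `NewformModel.EisChiPackage`, discharge theorem).

References: F. Diamond, J. Shurman, GTM 228 (2005), Thm. 4.5.1, §4.6 (Thm. 4.6.2), Prop. 5.2.3, Prop. 5.8.5, Thm. 9.6.6;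
J. Sturm, LNM 1240 (1987), Thm. 1; [BS04] Bennett–Skinner, Canad. J. Math. 56 (2004), Cor. 3.1. Cell records: module
M6χ = engine-2 record `engine/engine-2/results/M6chi/M6CHI-RECORD-g3.md` (certificates `…/certs/`, schema
`abcsig-m6chi-1`), referee second implementation `referee/m6chi-g17/M6CHI-REFEREE-g17.md` (14/14), lit pin
`lit/M6CHI-PIN.md`, lead ruling M6χ ADMISSIBLE (PLAN §10).
-/

namespace Summit.Ventures.AbcSig

/-! ## The quadratic character by Euler's criterion -/

/-- The Legendre symbol `(d/C)` for an odd prime `C`, COMPUTED by Euler's criterion: `d^{(C−1)/2} mod C` is `0`, `1`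
or `C − 1`, giving `0`, `1`, `−1`. (For other `C` this is just some integer-valued function.) -/
def eulerChi (C d : ℕ) : ℤ :=
  if d ^ (C / 2) % C = 0 then 0 else if d ^ (C / 2) % C = 1 then 1 else -1

/-- **`eulerChi` is the Legendre symbol** (Euler's criterion, [Mathlib `legendreSym.eq_pow`]): for an odd prime `C`,
`eulerChi C d = legendreSym C d`. This certifies the meaning of the character used by the checker below. -/
theorem eulerChi_eq_legendreSym (C : ℕ) [Fact C.Prime] (hC2 : C ≠ 2) (d : ℕ) :
    eulerChi C d = legendreSym C d := by
  have hCp : C.Prime := Fact.out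
  have h1C : 1 < C := hCp.one_lt
  have key : (((d ^ (C / 2) % C : ℕ) : ℤ) : ZMod C) = (legendreSym C d : ZMod C) := by
    rw [legendreSym.eq_pow, Int.cast_natCast, ZMod.natCast_mod, Nat.cast_pow, Int.cast_natCast]
  set e := d ^ (C / 2) % C with he
  have he_lt : e < C := Nat.mod_lt _ hCp.pos
  unfold eulerChi
  rw [← he]
  by_cases hd : ((d : ℤ) : ZMod C) = 0
  · -- `C ∣ d`: both sides vanish
    have hleg : legendreSym C d = 0 := (legendreSym.eq_zero_iff C d).mpr hd
    have hCd : C ∣ d := by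
      rw [Int.cast_natCast, ZMod.natCast_eq_zero_iff] at hd
      exact hd
    have he0 : e = 0 := by
      rw [he]
      exact Nat.mod_eq_zero_of_dvd (dvd_pow hCd (by omega : C / 2 ≠ 0))
    simp [he0, hleg]
  · rcases legendreSym.eq_one_or_neg_one C hd with hleg | hleg
    · -- residue `1`
      have he1 : e = 1 := by
        have h := key
        rw [hleg, Int.cast_one, Int.cast_natCast] at h
        have h' : (e : ZMod C) = ((1 : ℕ) : ZMod C) := by rw [Nat.cast_one]; exact h
        rw [ZMod.natCast_eq_natCast_iff'] at h'
        rw [Nat.mod_eq_of_lt he_lt, Nat.mod_eq_of_lt h1C] at h'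
        exact h'
      simp [he1, hleg]
    · -- residue `C − 1`
      have h := key
      rw [hleg, Int.cast_neg, Int.cast_one, Int.cast_natCast] at h
      have hne0 : e ≠ 0 := by
        intro h0
        rw [h0, Nat.cast_zero] at h
        have : (1 : ZMod C) = 0 := by
          have := congrArg (fun x => -x) h
          simpa using this.symm
        exact absurd this (by
          haveI : Fact (1 < C) := ⟨h1C⟩
          exact one_ne_zero)
      have hne1 : e ≠ 1 := by
        intro h1
        rw [h1, Nat.cast_one] at h
        have h2 : (2 : ZMod C) = 0 := by
          have := congrArg (fun x => x + 1) h
          simp only [neg_add_cancel] at this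
          rw [← this]; ring
        have h2' : ((2 : ℕ) : ZMod C) = 0 := by exact_mod_cast h2
        rw [ZMod.natCast_eq_zero_iff] at h2'
        exact hC2 ((Nat.prime_dvd_prime_iff_eq hCp Nat.prime_two).mp h2')
      simp [hne0, hne1, hleg]

/-! ## Character-twisted Eisenstein coefficients (integers) -/

/-- `σ₁^{χ,χ}(m) = Σ_{d ∣ m, d ≥ 1} χ(m/d)·χ(d)·d` with `χ = eulerChi C` (so `σ₁^{χ,χ}(0) = 0`): the coefficient of
`q^m`, `m ≥ 1`, in `E_χ = ½E₂^{χ,χ}` [DS05, Thm. 4.5.1 / §4.6, weight 2, `ψ = φ = χ`]. -/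
def sigmaChi (C m : ℕ) : ℤ :=
  (((List.range (m + 1)).filter fun d => decide (0 < d) && (m % d == 0)).map
    fun d => eulerChi C (m / d) * eulerChi C d * (d : ℤ)).sum

/-- Coefficient of `q^m` in `G_λ = Σ_{(t, λ_t) ∈ lam} λ_t · E_χ(tz)`: `Σ_t λ_t [t ∣ m] σ₁^{χ,χ}(m/t)`; in particular
`a_0(G_λ) = 0` (the constant term of `E₂^{χ,χ}` is `δ(χ)L(−1,χ) = 0` for non-trivial `χ`). -/
def eisChiCoeff (C : ℕ) (lam : List (ℕ × ℤ)) (m : ℕ) : ℤ :=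
  (lam.map fun tl => tl.2 * (if tl.1 ∣ m then sigmaChi C (m / tl.1) else 0)).sum

/-! ## The model-side statement -/

/-- **`M.EisensteinChiCongruent f ψ C lam B`** — `C` is an odd prime with `C² ∣ N`, the combination `lam` is supported
on `t ≥ 1` with `t·C² ∣ N` (so `G_λ = Σ λ_t E_χ(tz) ∈ M₂(Γ₀(N))`, `χ = (·/C)`), and the newform `f` (level `N`) is
congruent to `G_λ` under `ψ : Coeff f → k` up to `q^B`: for every `1 ≤ m ≤ B`, `ψ(a_m(f)) = a_m(G_λ)` in `k`, where
`a_m(f)` is `coeffOfFac N (c_·(f))` of a prime factorisation of `m` (equal to the `m`-th Fourier coefficient in the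
intended model). (`a_0`: both sides are `0`.) -/
def NewformModel.EisensteinChiCongruent (M : NewformModel) {N : ℕ} (f : M.Form N) {k : Type} [Field k]
    (ψ : M.Coeff N f →+* k) (C : ℕ) (lam : List (ℕ × ℤ)) (B : ℕ) : Prop :=
  C.Prime ∧ C ≠ 2 ∧ C ^ 2 ∣ N ∧ (∀ tl ∈ lam, tl.1 * C ^ 2 ∣ N ∧ 0 < tl.1) ∧
    ∀ m : ℕ, 1 ≤ m → m ≤ B → ∃ fac : List (ℕ × ℕ), isFactorisation m fac = true ∧
      ψ (coeffOfFac N (M.eig N f) fac) = ((eisChiCoeff C lam m : ℤ) : k)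

/-! ## Certificates and the checker -/

/-- An M6χ Eisenstein-congruence certificate for one orbit: the prime `(n, θ − r)`, inverses `(p, d_p⁻¹ mod n)` for
the listed eigenvalue entries, the conductor `C` of `χ = (·/C)`, the combination `λ = [(t, λ_t)]`, the number `B` of
coefficients, the prime factorisation of the level, and the prime factorisations of `1, …, B` (in this order). -/
structure EisChiCert where
  /-- the residue characteristic -/
  n : ℕ
  /-- `θ ≡ r (mod 𝔫)` -/
  r : ℤ
  /-- `(p, u_p)` with `d_p · u_p ≡ 1 (mod n)` -/
  dinv : List (ℕ × ℤ)
  /-- the odd prime `C` (`χ = (·/C)`, `C² ∣ N`) -/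
  C : ℕ
  /-- the Eisenstein combination `(t, λ_t)`: `G_λ = Σ λ_t E_χ(tz)` -/
  lam : List (ℕ × ℤ)
  /-- number of coefficients compared -/
  B : ℕ
  /-- prime factorisation of the level `N` -/
  facN : List (ℕ × ℕ)
  /-- prime factorisations of `m = 1, …, B` -/
  facs : List (List (ℕ × ℕ))

/-- The eigenvalue bookkeeping part of the certificate, as an `EisCert` (empty trivial-family combination), so that
`EisCert.eigAt` / `EisCert.eigZ` / `EisCert.map_eig_eq` of `Sieve/Eisenstein.lean` apply verbatim. -/
def EisChiCert.toEis (c : EisChiCert) : EisCert :=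
  { n := c.n, r := c.r, dinv := c.dinv, lam := [], B := c.B, facN := c.facN, facs := c.facs }

/-- Check of one coefficient index `m` with factorisation `fac`: `fac` factorises `m`, every prime of `fac` has a
usable entry, and `a_m(f) ≡ a_m(G_λ) (mod n)` for the integer representatives. -/
def EisChiCert.checkAt (c : EisChiCert) (N : ℕ) (X : OrbitData) (m : ℕ) (fac : List (ℕ × ℕ)) : Bool :=
  isFactorisation m fac && fac.all (fun pk => (c.toEis.eigAt X pk.1).isSome) &&
    ((coeffOfFac N (c.toEis.eigZ X) fac - eisChiCoeff c.C c.lam m) % (c.n : ℤ) == 0)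

/-- `checkAll c N X m facs`: `checkAt` for the indices `m, m+1, …` against the list `facs`. -/
def EisChiCert.checkAll (c : EisChiCert) (N : ℕ) (X : OrbitData) : ℕ → List (List (ℕ × ℕ)) → Bool
  | _, [] => true
  | m, fac :: facs => c.checkAt N X m fac && c.checkAll N X (m + 1) facs

/-- **The checker.** `C` an odd prime with `C² ∣ N`; `λ` supported on `t ≥ 1` with `t·C² ∣ N`; `facN` factorises `N`
with `6·B ≥ ψ(N)`; exactly `B` factorisations; and `checkAt` for every `m = 1, …, B`. -/
def EisChiCert.check (c : EisChiCert) (N : ℕ) (X : OrbitData) : Bool :=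
  decide c.C.Prime && decide (c.C ≠ 2) && decide (c.C ^ 2 ∣ N) &&
    c.lam.all (fun tl => decide (tl.1 * c.C ^ 2 ∣ N) && decide (0 < tl.1)) &&
    isFactorisation N c.facN && decide (psiOfFac c.facN ≤ 6 * c.B) && (c.facs.length == c.B) &&
    c.checkAll N X 1 c.facs

/-! ## Soundness -/

/-- One index: `checkAt = true` gives the congruence for `m` in `k`. -/
lemma EisChiCert.checkAt_sound (c : EisChiCert) {N : ℕ} (X : OrbitData) (M : NewformModel) (f : M.Form N)
    (θ : M.Coeff N f) (hθ : ∀ e ∈ X.coeffs, (e.d : M.Coeff N f) * M.eig N f e.ell = evalL θ e.g) {k : Type} [Field k]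
    [CharP k c.n] (ψ : M.Coeff N f →+* k) (hψ : ψ θ = (c.r : k)) (m : ℕ) (fac : List (ℕ × ℕ))
    (h : c.checkAt N X m fac = true) :
    isFactorisation m fac = true ∧ ψ (coeffOfFac N (M.eig N f) fac) = ((eisChiCoeff c.C c.lam m : ℤ) : k) := by
  simp only [EisChiCert.checkAt, Bool.and_eq_true, List.all_eq_true, beq_iff_eq] at h
  obtain ⟨⟨hfac, hsome⟩, hcong⟩ := h
  refine ⟨hfac, ?_⟩
  rw [map_coeffOfFac]
  have hchar : CharP k c.toEis.n := ‹CharP k c.n›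
  have hc : coeffOfFac N (fun p => ψ (M.eig N f p)) fac =
      coeffOfFac N (fun p => ((c.toEis.eigZ X p : ℤ) : k)) fac := by
    apply coeffOfFac_congr
    intro pk hpk
    have hs := hsome pk hpk
    obtain ⟨v, hv⟩ := Option.isSome_iff_exists.mp hs
    rw [c.toEis.map_eig_eq X M f θ hθ ψ hψ pk.1 v hv]
    simp [EisCert.eigZ, hv]
  rw [hc]
  have hcast : coeffOfFac N (fun p => ((c.toEis.eigZ X p : ℤ) : k)) fac =
      ((coeffOfFac N (c.toEis.eigZ X) fac : ℤ) : k) := by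
    have := map_coeffOfFac (Int.castRingHom k) N (c.toEis.eigZ X) fac
    simpa using this.symm
  rw [hcast]
  exact intCast_eq_of_emod_eq c.n hcong

/-- All indices: `checkAll m₀ facs = true` gives the congruence for `m₀ ≤ m < m₀ + |facs|`. -/
lemma EisChiCert.checkAll_sound (c : EisChiCert) {N : ℕ} (X : OrbitData) (M : NewformModel) (f : M.Form N)
    (θ : M.Coeff N f) (hθ : ∀ e ∈ X.coeffs, (e.d : M.Coeff N f) * M.eig N f e.ell = evalL θ e.g) {k : Type} [Field k]
    [CharP k c.n] (ψ : M.Coeff N f →+* k) (hψ : ψ θ = (c.r : k)) :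
    ∀ (facs : List (List (ℕ × ℕ))) (m₀ : ℕ), c.checkAll N X m₀ facs = true →
      ∀ m, m₀ ≤ m → m < m₀ + facs.length → ∃ fac, isFactorisation m fac = true ∧
        ψ (coeffOfFac N (M.eig N f) fac) = ((eisChiCoeff c.C c.lam m : ℤ) : k)
  | [], m₀, _, m, h1, h2 => by simp at h2; omega
  | fac :: facs, m₀, h, m, h1, h2 => by
      simp only [EisChiCert.checkAll, Bool.and_eq_true] at h
      obtain ⟨hhead, htail⟩ := h
      by_cases hm : m = m₀
      · subst hm
        exact ⟨fac, c.checkAt_sound X M f θ hθ ψ hψ m fac hhead⟩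
      · exact c.checkAll_sound X M f θ hθ ψ hψ facs (m₀ + 1) htail m (by omega)
          (by simp only [List.length_cons] at h2; omega)

/-- **Soundness of the M6χ checker.** If `c.check N X = true`, then for every newform `f` of level `N` carrying the
data `X` with generator `θ` and every ring homomorphism `ψ : Coeff f → k` to a field of characteristic `c.n` with
`ψ(θ) = r`: `M.EisensteinChiCongruent f ψ c.C c.lam c.B` and `SturmReaches N c.B`. -/
theorem EisChiCert.check_sound (c : EisChiCert) {N : ℕ} (X : OrbitData) (h : c.check N X = true) (M : NewformModel)
    (f : M.Form N) (θ : M.Coeff N f) (hθ : ∀ e ∈ X.coeffs, (e.d : M.Coeff N f) * M.eig N f e.ell = evalL θ e.g)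
    {k : Type} [Field k] [CharP k c.n] (ψ : M.Coeff N f →+* k) (hψ : ψ θ = (c.r : k)) :
    M.EisensteinChiCongruent f ψ c.C c.lam c.B ∧ SturmReaches N c.B := by
  simp only [EisChiCert.check, Bool.and_eq_true, List.all_eq_true, decide_eq_true_eq, beq_iff_eq] at h
  obtain ⟨⟨⟨⟨⟨⟨⟨hCp, hC2⟩, hCN⟩, hlam⟩, hfacN⟩, hpsi⟩, hlen⟩, hall⟩ := h
  refine ⟨⟨hCp, hC2, hCN, fun tl htl => hlam tl htl, ?_⟩, ⟨c.facN, hfacN, hpsi⟩⟩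
  intro m h1 h2
  exact c.checkAll_sound X M f θ hθ ψ hψ c.facs 1 hall m h1 (by rw [hlen]; omega)

/-! ## Sanity examples (kernel) -/

/-- `χ₃₇`: `(2/37) = −1`, `(3/37) = 1`, `(37/37) = 0`. -/
example : eulerChi 37 2 = -1 ∧ eulerChi 37 3 = 1 ∧ eulerChi 37 37 = 0 := by decide +kernel

/-- `a_p(E_χ) = χ(p)(1 + p)` at `p = 2, 3` for `χ = χ₃₇`, and `a_0 = 0`, `a_1 = 1`. -/
example : sigmaChi 37 2 = -3 ∧ sigmaChi 37 3 = 4 ∧ sigmaChi 37 0 = 0 ∧ sigmaChi 37 1 = 1 := by decide +kernel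

end Summit.Ventures.AbcSig
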